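import Summits.FinalStateConjecture.FinalStateConjecture.Theses.PhaseMixingCapture
import Literature.Geometry.Lorentzian.AchronalBoundary
import Literature.Geometry.Lorentzian.KerrSurfaceGravity

/-!
# Crux `CaptureSuffices` (stmt-FinalStateConjecture-9953) — first lemmas of three crux ideas
(crux-ideate round 1, ideator 1; planner-cruxidea-stmt-FinalStateConjecture-9953-1-0)

* `convergesToKerr_transfer_futureSet` — idea `quiet-past-cone-surgery`: the typed capture
  conclusion `Spacetime.ConvergesToKerr` is transferable along a time-orientation preserving
  isometric open embedding of an OPEN FUTURE SET of the auxiliary development into the big one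
  (statement only; proof = time-compression reparametrisation of the Kerr chart + push-up
  `J⁺ ∘ I⁺ ⊆ I⁺` inside the future set + near-Kerr causal reachability of later `t*`-slabs);
  its GLOBAL-embedding case `ConvergesToKerr.comp_image` is PROVED below (companions section).
* `kick_margin_and_edge_lift` — idea `kick-lifts-the-slice-edge`: the arithmetic of a spinless
  mass gain `M ↦ M' > M` at fixed `J = M²` (extremal): the new hole is sub-extremal with
  `1 − (a'/M')² = 1 − (M/M')⁴`, and the inner edge sphere `{r = M'}` of the capture slice
  `Kerr.slice a' M'` has area `4π(M'² + a'²) > 8πM²` = area of the old extremal horizon (AM–GM),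
  i.e. the degenerate horizon (where Aretakis hair lives) drops below the typed slice. PROVED.
* `extremality_gauge_pins` — idea `extremality-gauge-theta`: two monotone charges (Bondi mass ↓,
  horizon area ↑) pin the tracked Kerr parameters and bound the final extremality gap from below
  by the gauge `Θ(T) = A(T)/(8π M_B(T)²)`. PROVED (elementary real analysis), together with the
  exponent law `kick_enters_basin_of_gamma_lt_half` of the kick idea.
-/

noncomputable section

open Bundle Set Function Filter Topology TopologicalSpace
open scoped Manifold ContDiff

namespace Summit.FinalStateConjecture.FinalStateConjecture.Cruxes.CaptureSuffices

open Literature.Geometry.Lorentzian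

/-! ### Idea `quiet-past-cone-surgery`: transfer of the capture conclusion along future sets -/

/-- **Transfer of `ConvergesToKerr` along an isometry of an open future set.** Let `W₀` be an open
FUTURE set (`I⁺(W₀) ⊆ W₀`) of the spacetime `𝓢₀` (the maximal development of the auxiliary,
quiet-past Cauchy datum) and `φ : W₀ → 𝓢` a smooth open embedding into the spacetime `𝓢` (the
maximal development of the large datum) which is isometric and preserves the time orientations.
If `𝓢₀` converges to `g_{M,a}` in `Cᵏ` in a region `𝒟₀ ⊆ W₀` (the typed conclusion of
`NearExtremalKappaCapture` / `BulkKerrCapture`), then `𝓢` converges to `g_{M,a}` in `Cᵏ` in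
`φ(𝒟₀)`. In the line, `W₀ = I⁺(Ñ)` for the late bifurcate null hypersurface `Ñ` of the auxiliary
development whose future is, by construction (gluing along `N` + MGHD maximality), isometric to
`I⁺(N)` in the large development. -/
theorem convergesToKerr_transfer_futureSet
    {𝓢₀ 𝓢 : Spacetime.{0} 4} (W₀ : Opens 𝓢₀.carrier)
    (hW₀ : 𝓢₀.metric.IsFutureSet 𝓢₀.timeOrientation (W₀ : Set 𝓢₀.carrier))
    (φ : W₀ → 𝓢.carrier) (hφs : ContMDiff (𝓡 4) (𝓡 4) ∞ φ) (hφo : IsOpenEmbedding φ)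
    (hφi : ∀ y : W₀,
      pullbackBilin (I := 𝓡 4) (I' := 𝓡 4) φ 𝓢.metric.val y = 𝓢₀.metric.val y.1)
    (hφτ : ∀ y : W₀, 𝓢.timeOrientation.IsFutureDirected
      (mfderiv (𝓡 4) (𝓡 4) φ y (𝓢₀.timeOrientation.vectorField y.1)))
    {𝒟₀ : Set 𝓢₀.carrier} (h𝒟₀ : 𝒟₀ ⊆ (W₀ : Set 𝓢₀.carrier)) {M a : ℝ} {k : ℕ}
    (h : 𝓢₀.ConvergesToKerr 𝒟₀ M a k) :
    𝓢.ConvergesToKerr (φ '' (Subtype.val ⁻¹' 𝒟₀)) M a k := by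
  sorry


end Summit.FinalStateConjecture.FinalStateConjecture.Cruxes.CaptureSuffices

/-! ### Proved companions of the transfer lemma: the GLOBAL-embedding case
(`ConvergesTo.comp_of_surjective` of `ConvergenceTransport.lean` with surjectivity dropped and the
region replaced by its image). The first lemma above is the same statement for an isometry defined
only on an open FUTURE set; these companions show that everything except the future-set
bookkeeping (time-compression of the chart, push-up inside `W₀`) is already formal. -/

namespace Literature.Geometry.Lorentzian.Spacetime

variable {𝓢₀ 𝓢 : Spacetime.{0} 4} (B : ModelBackground)

/-- Late-time embeddings push forward along (not necessarily surjective) isometric open embeddings,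
with the region replaced by its image. -/
theorem IsLateEmbedding.comp_image {𝒟 : Set 𝓢₀.carrier} {τ₀ : ℝ} {Ψ : B.domain → 𝓢₀.carrier}
    (hΨ : 𝓢₀.IsLateEmbedding B 𝒟 τ₀ Ψ) {φ : 𝓢₀.carrier → 𝓢.carrier}
    (hφs : ContMDiff (𝓡 4) (𝓡 4) ∞ φ) (hopen : IsOpenEmbedding φ)
    (hφ : ∀ y, pullbackBilin (I := 𝓡 4) (I' := 𝓡 4) φ 𝓢.metric.val y = 𝓢₀.metric.val y)
    (hτ : 𝓢₀.timeOrientation.PreservesTimeOrientation φ 𝓢.timeOrientation) :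
    𝓢.IsLateEmbedding B (φ '' 𝒟) τ₀ (φ ∘ Ψ) where
  contMDiff := hφs.comp hΨ.contMDiff
  isOpenEmbedding := hopen.comp hΨ.isOpenEmbedding
  image_subset := by
    rw [image_comp]
    exact image_mono hΨ.image_subset
  diff_subset_causalPast := by
    rintro x ⟨⟨x₀, hx₀𝒟, rfl⟩, hx⟩
    have hx₀ : x₀ ∉ Ψ '' B.lateRegion τ₀ := fun ⟨z, hz, hzx⟩ ↦ hx ⟨z, hz, by simp [← hzx]⟩
    have h := hΨ.diff_subset_causalPast ⟨hx₀𝒟, hx₀⟩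
    have h' := LorentzianMetric.image_causalPast_subset (hφs.mdifferentiable (by simp)) hτ hφ
      (Ψ '' B.timeSlab τ₀)
    rw [image_comp]
    exact h' (mem_image_of_mem φ h)

/-- **`ConvergesTo` pushes forward along isometric open embeddings** (surjectivity dropped from
`ConvergesTo.comp_of_surjective`; the region becomes its image). -/
theorem ConvergesTo.comp_image {𝒟 : Set 𝓢₀.carrier} {k : ℕ} (h : 𝓢₀.ConvergesTo B 𝒟 k)
    {φ : 𝓢₀.carrier → 𝓢.carrier} (hφs : ContMDiff (𝓡 4) (𝓡 4) ∞ φ) (hopen : IsOpenEmbedding φ)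
    (hφ : ∀ y, pullbackBilin (I := 𝓡 4) (I' := 𝓡 4) φ 𝓢.metric.val y = 𝓢₀.metric.val y)
    (hτ : 𝓢₀.timeOrientation.PreservesTimeOrientation φ 𝓢.timeOrientation) :
    𝓢.ConvergesTo B (φ '' 𝒟) k := by
  obtain ⟨τ₀, Ψ, hΨ, ht⟩ := h
  refine ⟨τ₀, φ ∘ Ψ, hΨ.comp_image B hφs hopen hφ hτ, ?_⟩
  have hdev : 𝓢.deviationCk B (φ ∘ Ψ) k = 𝓢₀.deviationCk B Ψ k := by
    funext τ
    unfold deviationCk deviationExtend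
    rw [deviation_comp B (hφs.mdifferentiable (by simp)) hφ
      (hΨ.contMDiff.mdifferentiable (by simp))]
  rw [hdev]
  exact ht

/-- `ConvergesToKerr` pushes forward along isometric open embeddings. -/
theorem ConvergesToKerr.comp_image {𝒟 : Set 𝓢₀.carrier} {M a : ℝ} {k : ℕ}
    (h : 𝓢₀.ConvergesToKerr 𝒟 M a k)
    {φ : 𝓢₀.carrier → 𝓢.carrier} (hφs : ContMDiff (𝓡 4) (𝓡 4) ∞ φ) (hopen : IsOpenEmbedding φ)
    (hφ : ∀ y, pullbackBilin (I := 𝓡 4) (I' := 𝓡 4) φ 𝓢.metric.val y = 𝓢₀.metric.val y)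
    (hτ : 𝓢₀.timeOrientation.PreservesTimeOrientation φ 𝓢.timeOrientation) :
    𝓢.ConvergesToKerr (φ '' 𝒟) M a k :=
  ConvergesTo.comp_image (Kerr.background M a) h hφs hopen hφ hτ


end Literature.Geometry.Lorentzian.Spacetime

namespace Summit.FinalStateConjecture.FinalStateConjecture.Cruxes.CaptureSuffices

open Literature.Geometry.Lorentzian

/-! ### Idea `kick-lifts-the-slice-edge`: arithmetic of a spinless kick at extremality -/

/-- **Spinless mass gain at extremality: sub-extremal margin and edge lift.** For an extremal hole
(`J = M²`) absorbing energy `M' − M > 0` at fixed angular momentum, the post-kick spin parameter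
`a' = J/M' = M²/M'` satisfies: (i) `|a'| < M'` (sub-extremal); (ii) the extremality gap is
`1 − (a'/M')² = 1 − (M/M')⁴` (`≈ 4(M'−M)/M`, SQUARE-ROOT gain `√gap ≈ 2√(δM/M)` against a
perturbation of size `O(δM)`); (iii) `2M² < M'² + a'²`: the coordinate sphere `{r = M'}` bounding
the capture slice `Kerr.slice a' M' = {t* = 0, r > M'}` from inside has Kerr–Schild area
`4π(M'² + a'²)` strictly larger than `8πM²`, the area of the old extremal horizon — the degenerate
horizon carrying the Aretakis hair lies below the inner edge of the typed slice. -/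
theorem kick_margin_and_edge_lift {M M' : ℝ} (hM : 0 < M) (hMM' : M < M') :
    Kerr.IsSubextremal M' (M ^ 2 / M') ∧
      1 - (M ^ 2 / M' / M') ^ 2 = 1 - (M / M') ^ 4 ∧
      2 * M ^ 2 < M' ^ 2 + (M ^ 2 / M') ^ 2 := by
  have hM' : 0 < M' := hM.trans hMM'
  refine ⟨?_, ?_, ?_⟩
  · -- |M²/M'| = M²/M' < M' ⟺ M² < M'²
    unfold Kerr.IsSubextremal
    rw [abs_of_pos (by positivity)]
    rw [div_lt_iff₀ hM']
    nlinarith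
  · field_simp
  · -- AM–GM with strict inequality since M'² ≠ M²
    have h1 : (M ^ 2 / M') ^ 2 = M ^ 4 / M' ^ 2 := by
      field_simp
    rw [h1]
    have hM'2 : 0 < M' ^ 2 := by positivity
    rw [← sub_pos]
    have key : M' ^ 2 + M ^ 4 / M' ^ 2 - 2 * M ^ 2 = (M' ^ 2 - M ^ 2) ^ 2 / M' ^ 2 := by
      field_simp
      ring
    rw [key]
    apply div_pos _ hM'2
    have hne : M' ^ 2 - M ^ 2 ≠ 0 := by nlinarith
    positivity

/-- **The exponent law** (same idea): if the κ-power basin of `NearExtremalKappaCapture` has radius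
`c · χ^γ` with `γ < 1/2`, then for every absorbed fraction `f > 0` and lingering fraction `θ > 0`
a small enough kick `δ` leaves a residual of norm `√(θ δ)` INSIDE the basin of the gap `χ = f δ`
it created: `√(θδ) < c (fδ)^γ` for all small `δ > 0`. (For `γ ≥ 1/2` this fails for small `δ`
and the line needs a finite-time ringdown estimate instead.) -/
theorem kick_enters_basin_of_gamma_lt_half {γ c f θ : ℝ} (hγ : γ < 1 / 2) (hc : 0 < c)
    (hf : 0 < f) (hθ : 0 < θ) :
    ∃ δ₀ > 0, ∀ δ : ℝ, 0 < δ → δ < δ₀ → Real.sqrt (θ * δ) < c * (f * δ) ^ γ := by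
  set ε : ℝ := 1 / 2 - γ with hε_def
  have hε : 0 < ε := by linarith
  set K : ℝ := c * f ^ γ / Real.sqrt θ with hK_def
  have hsqθ : 0 < Real.sqrt θ := Real.sqrt_pos.mpr hθ
  have hfγ : 0 < f ^ γ := Real.rpow_pos_of_pos hf γ
  have hK : 0 < K := by positivity
  refine ⟨K ^ (1 / ε), Real.rpow_pos_of_pos hK _, fun δ hδ hδK ↦ ?_⟩
  -- δ^ε < K
  have hδε : δ ^ ε < K := by
    have h1 : δ ^ ε < (K ^ (1 / ε)) ^ ε := Real.rpow_lt_rpow hδ.le hδK hε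
    have h2 : (K ^ (1 / ε)) ^ ε = K := by
      rw [← Real.rpow_mul hK.le, one_div_mul_cancel hε.ne', Real.rpow_one]
    rwa [h2] at h1
  -- rewrite both sides with rpow
  have hsqrt : Real.sqrt (θ * δ) = Real.sqrt θ * δ ^ (1 / 2 : ℝ) := by
    rw [Real.sqrt_mul hθ.le, Real.sqrt_eq_rpow δ]
  have hmul : (f * δ) ^ γ = f ^ γ * δ ^ γ := Real.mul_rpow hf.le hδ.le
  rw [hsqrt, hmul]
  -- goal: √θ * δ^(1/2) < c * (f^γ * δ^γ)
  have hδγ : 0 < δ ^ γ := Real.rpow_pos_of_pos hδ γ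
  have hsplit : δ ^ (1 / 2 : ℝ) = δ ^ ε * δ ^ γ := by
    rw [← Real.rpow_add hδ]; congr 1; simp [hε_def]
  rw [hsplit]
  have : Real.sqrt θ * (δ ^ ε * δ ^ γ) = (Real.sqrt θ * δ ^ ε) * δ ^ γ := by ring
  rw [this, show c * (f ^ γ * δ ^ γ) = (c * f ^ γ) * δ ^ γ by ring]
  apply mul_lt_mul_of_pos_right _ hδγ
  -- √θ * δ^ε < c f^γ  ⟸ δ^ε < K = c f^γ/√θ
  have := (lt_div_iff₀ hsqθ).mp hδε
  linarith [this]

/-! ### Idea `extremality-gauge-theta`: two monotone charges pin the parameters -/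

/-- `r₊(M,a)/M = 1 + √(1 − (a/M)²)` for `0 < M` (Kerr horizon radius over mass; extremality
parameter). -/
theorem rPlus_div_eq {M a : ℝ} (hM : 0 < M) :
    Kerr.rPlus M a / M = 1 + Real.sqrt (1 - (a / M) ^ 2) := by
  unfold Kerr.rPlus
  rw [add_div, div_self hM.ne']
  congr 1
  rw [← Real.sqrt_sq hM.le, ← Real.sqrt_div' _ , Real.sqrt_sq hM.le]
  · congr 1
    field_simp
  · positivity

/-- **Extremality gauge pins the tracked parameters.** Let `T ↦ M T` (Bondi mass at the cut through
the tracked window: non-increasing, Bondi mass loss) and `T ↦ A T` (event-horizon cross-section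
area: non-decreasing, area theorem; bounded) be the two monotone charges, and `(Mt T, aT T)` the
Kerr parameters tracked on the window at chart time `T` with `|aT| ≤ Mt`, `Mt ≥ m > 0`, pinned to
the charges up to an error `η T → 0` (`|M − Mt| ≤ η`, `|A − 8π Mt r₊(Mt, at)| ≤ η`, the Kerr
horizon area being `4π(r₊² + a²) = 8π M r₊`). Then the parameters converge, `(Mt, |aT|) → (Mf, af)`
with `0 < Mf`, `|af| ≤ Mf`, and the extremality gauge never exceeds its final value:
`A T / (8π (M T)²) ≤ r₊(Mf, af)/Mf = 1 + √(1 − af²/Mf²)` for every `T` — in particular a final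
EXTREMAL hole (`af = Mf`) forces `A T ≤ 8π (M T)²` at ALL tracked times, and one time `T₁` with
`A T₁ > 8π (M T₁)²` bounds the final gap from below. No Liouville/modulation theorem is used. -/
theorem extremality_gauge_pins (M A Mt aT η : ℝ → ℝ)
    (hM : Antitone M) (hA : Monotone A) (hAbdd : BddAbove (range A))
    (hη : Tendsto η atTop (𝓝 0))
    (hm : ∃ m > 0, ∀ T, m ≤ Mt T) (hsub : ∀ T, |aT T| ≤ Mt T)
    (htrackM : ∀ T, |M T - Mt T| ≤ η T)
    (htrackA : ∀ T, |A T - 8 * Real.pi * Mt T * Kerr.rPlus (Mt T) (aT T)| ≤ η T) :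
    ∃ Mf af : ℝ, 0 < Mf ∧ 0 ≤ af ∧ af ≤ Mf ∧
      Tendsto Mt atTop (𝓝 Mf) ∧ Tendsto (fun T ↦ |aT T|) atTop (𝓝 af) ∧
      ∀ T, A T / (8 * Real.pi * (M T) ^ 2) ≤ Kerr.rPlus Mf af / Mf := by
  obtain ⟨m, hm0, hmle⟩ := hm
  have hMt_pos : ∀ T, 0 < Mt T := fun T ↦ hm0.trans_le (hmle T)
  -- η is eventually ≤ 1, and nonneg always
  have hη_nonneg : ∀ T, 0 ≤ η T := fun T ↦ (abs_nonneg _).trans (htrackM T)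
  obtain ⟨T₀, hT₀⟩ : ∃ T₀, ∀ T ≥ T₀, η T ≤ 1 := by
    have := (hη.eventually (ge_mem_nhds (show (0:ℝ) < 1 by norm_num)))
    rw [eventually_atTop] at this
    exact this
  -- Step 1: M bounded below by m - 1, converges to L := ⨅ M
  have hMlb : ∀ T, m - 1 ≤ M T := by
    intro T
    rcases le_total T T₀ with hT | hT
    · have h1 : M T₀ ≤ M T := hM hT
      have h2 : Mt T₀ - η T₀ ≤ M T₀ := by
        have := htrackM T₀; rw [abs_le] at this; linarith [this.1]
      linarith [hmle T₀, hT₀ T₀ le_rfl]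
    · have h2 : Mt T - η T ≤ M T := by
        have := htrackM T; rw [abs_le] at this; linarith [this.1]
      linarith [hmle T, hT₀ T hT]
  have hMbdd : BddBelow (range M) := ⟨m - 1, by rintro _ ⟨T, rfl⟩; exact hMlb T⟩
  set L : ℝ := ⨅ T, M T with hL
  have hM_tend : Tendsto M atTop (𝓝 L) := tendsto_atTop_ciInf hM hMbdd
  -- Mt → L
  have hdiff : Tendsto (fun T ↦ M T - Mt T) atTop (𝓝 0) := by
    apply squeeze_zero_norm (fun T ↦ ?_) hη
    simpa [Real.norm_eq_abs] using htrackM T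
  have hMt_tend : Tendsto Mt atTop (𝓝 L) := by
    have : Tendsto (fun T ↦ M T - (M T - Mt T)) atTop (𝓝 (L - 0)) := hM_tend.sub hdiff
    simpa using this
  have hL_ge : m ≤ L := ge_of_tendsto' hMt_tend (fun T ↦ hmle T)
  have hL_pos : 0 < L := hm0.trans_le hL_ge
  have hML : ∀ T, L ≤ M T := fun T ↦ hM.le_of_tendsto hM_tend T
  -- Step 2: A → Af
  set Af : ℝ := ⨆ T, A T with hAf
  have hA_tend : Tendsto A atTop (𝓝 Af) := tendsto_atTop_ciSup hA hAbdd
  have hA_le : ∀ T, A T ≤ Af := fun T ↦ le_ciSup hAbdd T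
  -- Step 3: g := 8π Mt rPlus → Af
  have hg_tend : Tendsto (fun T ↦ 8 * Real.pi * Mt T * Kerr.rPlus (Mt T) (aT T)) atTop (𝓝 Af) := by
    have hd : Tendsto (fun T ↦ A T - 8 * Real.pi * Mt T * Kerr.rPlus (Mt T) (aT T)) atTop (𝓝 0) := by
      apply squeeze_zero_norm (fun T ↦ ?_) hη
      simpa [Real.norm_eq_abs] using htrackA T
    have := hA_tend.sub hd
    simpa using this
  -- Step 4: q := rPlus/Mt → Θf := Af/(8π L²)
  set Θf : ℝ := Af / (8 * Real.pi * L ^ 2) with hΘf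
  have hq_tend : Tendsto (fun T ↦ Kerr.rPlus (Mt T) (aT T) / Mt T) atTop (𝓝 Θf) := by
    have hden : Tendsto (fun T ↦ 8 * Real.pi * (Mt T) ^ 2) atTop (𝓝 (8 * Real.pi * L ^ 2)) :=
      (hMt_tend.pow 2).const_mul _
    have hne : (8 * Real.pi * L ^ 2) ≠ 0 := by positivity
    have key : (fun T ↦ Kerr.rPlus (Mt T) (aT T) / Mt T) =
        fun T ↦ (8 * Real.pi * Mt T * Kerr.rPlus (Mt T) (aT T)) / (8 * Real.pi * (Mt T) ^ 2) := by
      funext T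
      have hMtT := (hMt_pos T).ne'
      field_simp
    rw [key]
    exact hg_tend.div hden hne
  -- Step 5: s := √(1 - (aT/Mt)²) = q - 1 → Θf - 1
  have hs_eq : ∀ T, Real.sqrt (1 - (aT T / Mt T) ^ 2) = Kerr.rPlus (Mt T) (aT T) / Mt T - 1 := by
    intro T; rw [rPlus_div_eq (hMt_pos T)]; ring
  have hs_tend : Tendsto (fun T ↦ Real.sqrt (1 - (aT T / Mt T) ^ 2)) atTop (𝓝 (Θf - 1)) := by
    simp_rw [hs_eq]; exact hq_tend.sub_const 1
  have hu_nonneg : ∀ T, 0 ≤ 1 - (aT T / Mt T) ^ 2 := by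
    intro T
    have h1 : (aT T / Mt T) ^ 2 ≤ 1 := by
      rw [div_pow, div_le_one (pow_pos (hMt_pos T) 2)]
      exact (sq_abs (aT T)).symm ▸ pow_le_pow_left₀ (abs_nonneg _) (hsub T) 2
    linarith
  have hs_le_one : ∀ T, Real.sqrt (1 - (aT T / Mt T) ^ 2) ≤ 1 := by
    intro T
    rw [Real.sqrt_le_one]
    nlinarith [sq_nonneg (aT T / Mt T)]
  have hΘ1_nonneg : 0 ≤ Θf - 1 := ge_of_tendsto' hs_tend (fun T ↦ Real.sqrt_nonneg _)
  have hΘ1_le : Θf - 1 ≤ 1 := le_of_tendsto' hs_tend hs_le_one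
  -- Step 6: (aT/Mt)² = 1 - s² → 1 - (Θf-1)² ; |aT| → af
  set af : ℝ := L * Real.sqrt (1 - (Θf - 1) ^ 2) with haf
  have hratio_tend : Tendsto (fun T ↦ |aT T| / Mt T) atTop (𝓝 (Real.sqrt (1 - (Θf - 1) ^ 2))) := by
    have h1 : Tendsto (fun T ↦ 1 - (Real.sqrt (1 - (aT T / Mt T) ^ 2)) ^ 2) atTop
        (𝓝 (1 - (Θf - 1) ^ 2)) := (hs_tend.pow 2).const_sub 1
    have h2 : ∀ T, 1 - (Real.sqrt (1 - (aT T / Mt T) ^ 2)) ^ 2 = (|aT T| / Mt T) ^ 2 := by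
      intro T
      rw [Real.sq_sqrt (hu_nonneg T), div_pow, div_pow, sq_abs]; ring
    simp_rw [h2] at h1
    have h3 := h1.sqrt
    refine h3.congr' (Eventually.of_forall fun T ↦ ?_)
    exact Real.sqrt_sq (div_nonneg (abs_nonneg _) (hMt_pos T).le)
  have haT_tend : Tendsto (fun T ↦ |aT T|) atTop (𝓝 af) := by
    have := hMt_tend.mul hratio_tend
    refine this.congr' (Eventually.of_forall fun T ↦ ?_)
    field_simp [(hMt_pos T).ne']
  -- Step 7/8: properties of af and rPlus L af / L = Θf
  have hsq_le : Real.sqrt (1 - (Θf - 1) ^ 2) ≤ 1 := by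
    rw [Real.sqrt_le_one]; nlinarith
  have haf_nonneg : 0 ≤ af := mul_nonneg hL_pos.le (Real.sqrt_nonneg _)
  have haf_le : af ≤ L := by
    calc af = L * Real.sqrt (1 - (Θf - 1) ^ 2) := rfl
      _ ≤ L * 1 := by gcongr
      _ = L := mul_one L
  have hrPlus : Kerr.rPlus L af / L = Θf := by
    rw [rPlus_div_eq hL_pos]
    have h1 : (af / L) ^ 2 = 1 - (Θf - 1) ^ 2 := by
      rw [haf, mul_div_cancel_left₀ _ hL_pos.ne', Real.sq_sqrt]
      nlinarith
    rw [h1, sub_sub_cancel, Real.sqrt_sq hΘ1_nonneg]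
    ring
  refine ⟨L, af, hL_pos, haf_nonneg, haf_le, hMt_tend, haT_tend, fun T ↦ ?_⟩
  rw [hrPlus]
  have hΘf_nonneg : 0 ≤ Θf := by linarith
  have hden_pos : 0 < 8 * Real.pi * (M T) ^ 2 := by
    have := (hL_pos.trans_le (hML T)); positivity
  rcases lt_or_ge (A T) 0 with hAT | hAT
  · exact (div_nonpos_of_nonpos_of_nonneg hAT.le hden_pos.le).trans hΘf_nonneg
  · have hAf_nonneg : 0 ≤ Af := hAT.trans (hA_le T)
    have hL2 : 8 * Real.pi * L ^ 2 ≤ 8 * Real.pi * (M T) ^ 2 := by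
      have : L ^ 2 ≤ (M T) ^ 2 := pow_le_pow_left₀ hL_pos.le (hML T) 2
      have h8 : (0:ℝ) ≤ 8 * Real.pi := by positivity
      exact mul_le_mul_of_nonneg_left this h8
    rw [hΘf]
    exact div_le_div₀ hAf_nonneg (hA_le T) (by positivity) hL2

end Summit.FinalStateConjecture.FinalStateConjecture.Cruxes.CaptureSuffices

end
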